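import Literature.Computability.Complexity.RossmanMonotoneCliqueFinite
import Literature.Computability.Complexity.RossmanMonotoneCliqueThm2Proofs
import HarnessLib

/-!
# Rossman 2010, Theorem 1 relative to an arbitrary background graph

Two immediate corollaries of Theorem 1 of

* B. Rossman, *The monotone complexity of k-clique on random graphs*, FOCS 2010, pp. 193–201
  (full version 2009; SIAM J. Comput. 43 (2014) 256–279), Theorem 1 (p. 4) [Rossman2010],

in its finite, one-large-`n` form `thm1_finite` (`RossmanMonotoneCliqueFinite.lean`: for `k ≥ 5`,
`0 < δ ≤ k⁻³`, `η > 0`, `n` satisfying the explicit largeness conditions `LargeN k δ c₀ η n`, and a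
circuit `C` over `{∧₂, ∨₂, 0, 1}` on the edges of `Kₙ` of size `≤ c₀ n^{k/4}` with
`Pr_A[C(K_A) = 1] ≥ η`, one has `Pr[C(G(n, p⁻)) = 1] ≥ 1 - exp(-n^{c'})`, where
`p⁻ = pMinus k δ n = n^{-2(1+δ)/(k-1)}` and `c' = cPrime k δ`), obtained by applying it to the
**restriction** `C^x : y ↦ C(x ∨ y)` of `C` at a fixed background graph `x`
(`Circuit.exists_restrict_sup` of `RossmanMonotoneCliqueThm2Proofs.lean`, the device of §7 of the
paper: relabel the inputs in `E(x)` by the constant `1`; this costs at most one extra gate, whence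
the `+ 1` in the size hypotheses below).

* `thm1_relative` — **Theorem 1 relative to an arbitrary background** ("a planted clique is worth
  at most one admissible dose"): for a small monotone circuit `C` and ANY background graph `x`,
  `Pr_A[C(x ∪ K_A) = 1] ≤ η + e^{-n^{c'}} + Pr_{G⁻ ∼ G(n,p⁻)}[C(x ∪ G⁻) = 1]`.
  Informally: on top of any background, the fraction of planted `k`-cliques accepted by `C`
  exceeds the probability that `C` accepts a fresh, independent subcritical sprinkle
  `G(n, n^{-2(1+δ)/(k-1)})` by at most `η + e^{-n^{c'}}`. Proof: if `Pr_A[C(x ∪ K_A) = 1] < η`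
  there is nothing to prove; otherwise `C^x` satisfies the hypotheses of `thm1_finite`.
* `rsd_at_admissible_dose` — the same inequality **averaged over a random background**
  `x ∼ G(n, q)` (any `0 ≤ q ≤ 1`), written out as finite weighted sums with the weights
  `gnpWeight n q x = q^{e(x)} (1-q)^{C(n,2)-e(x)}`:
  `E_x[Pr_A[C(x ∪ K_A) = 1]] - E_x E_{G⁻}[C(x ∪ G⁻)] ≤ η + e^{-n^{c'}}`.
  This is the dense-dose endpoint (sprinkle exponent `σ = 2(1+δ)/(k-1)`, i.e. the sprinkle is
  `G(n, n^{-σ})` with `σ` just above the `k`-clique threshold exponent `2/(k-1)`) of the "relative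
  sparse-dose" statement studied under route PneNP/OneSlice (crux `SingleThreshold`, line
  `two-round-exposure`), whose sparse end (`σ > 1 + 1/(k-1)`, a sprinkle too sparse to contain
  anything but isolated edges near a `k`-set) is equivalent to Rossman's open single-threshold
  problem (§1 of the paper: is `k`-CLIQUE hard for monotone circuits a.a.s. at ONE threshold
  density?). Only the dense endpoint is a theorem; nothing about sparser doses is claimed here.

Both statements carry the largeness hypothesis `LargeN k δ (c₀ + 1) η n` at the constant `c₀ + 1`
(all its conditions hold for every sufficiently large `n`, `eventually_largeN` of
`RossmanMonotoneCliqueProofs.lean`) and the size hypothesis `size C + 1 ≤ (c₀ + 1) n^{k/4}`, so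
that the restriction `C^x`, of size `≤ size C + 1`, is admissible in `thm1_finite` with constant
`c₀ + 1`.

Not here: the sequence / asymptotic forms (they follow verbatim as in
`rossman2010Thm1At_of_le`), and any statement at sprinkle densities other than `p⁻`.

## References

* [Rossman2010] B. Rossman, The monotone complexity of k-clique on random graphs, FOCS 2010,
  193–201; SIAM J. Comput. 43 (2014) 256–279 — Theorem 1 (p. 4), §6 (pp. 8–9), §7 (p. 10).
-/

noncomputable section

namespace Literature.Computability.Complexity

open Finset
open scoped Classical

variable {n : ℕ}

/-- **Rossman 2010, Theorem 1, relative to an arbitrary background graph** (corollary of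
Theorem 1, in-tree `thm1_finite`, applied to the restriction `C^x(y) = C(x ∨ y)` of §7): for
`k ≥ 5`, `0 < δ ≤ k⁻³`, `η > 0`, `n` with `LargeN k δ (c₀ + 1) η n`, a circuit `C` over
`{∧₂, ∨₂, 0, 1}` on the edges of `Kₙ` with `size C + 1 ≤ (c₀ + 1) n^{k/4}`, and ANY edge vector
`x`,
`Pr_A[C(x ∪ K_A) = 1] ≤ η + exp(-n^{c'}) + Pr_{G⁻ ∼ G(n, p⁻)}[C(x ∪ G⁻) = 1]`,
`p⁻ = n^{-2(1+δ)/(k-1)}`, `c' = cPrime k δ`: on top of any background, a planted random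
`k`-clique is accepted at most `η + e^{-n^{c'}}` more often than a fresh subcritical sprinkle.
Proof: either `Pr_A[C(x ∪ K_A) = 1] < η`, or `thm1_finite` applies to `C^x`
(`Circuit.exists_restrict_sup`, size `≤ size C + 1`). [cite: Rossman2010, Thm 1 (p. 4)] -/
theorem thm1_relative {n k : ℕ} (hk : 5 ≤ k) {δ : ℝ} (hδ0 : 0 < δ) (hδ1 : δ ≤ 1 / (k : ℝ) ^ 3)
    {c₀ η : ℝ} (hη : 0 < η) (hn : LargeN k δ (c₀ + 1) η n)
    (C : Circuit ((⊤ : SimpleGraph (Fin n)).edgeSet)) (hC : C.IsOver monotoneBasis01)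
    (hsize : (C.size : ℝ) + 1 ≤ (c₀ + 1) * (n : ℝ) ^ ((k : ℝ) / 4))
    (x : (⊤ : SimpleGraph (Fin n)).edgeSet → Bool) :
    kSubsetProb n k (fun A => C.eval (x ⊔ cliqueVec A) = true) ≤
      η + Real.exp (-((n : ℝ) ^ cPrime k δ)) +
        gnpProb n (pMinus k δ n) (univ.filter fun y => C.eval (x ⊔ y) = true) := by
  have hexp := Real.exp_pos (-((n : ℝ) ^ cPrime k δ))
  have hp0 : 0 ≤ pMinus k δ n := Real.rpow_nonneg (Nat.cast_nonneg n) _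
  have hp1 : pMinus k δ n ≤ 1 := by have := hn.hp; linarith
  have hg0 := gnpProb_nonneg hp0 hp1 (univ.filter fun y => C.eval (x ⊔ y) = true)
  by_cases hacc : η ≤ kSubsetProb n k (fun A => C.eval (x ⊔ cliqueVec A) = true)
  · -- the restriction `C^x` is admissible in Theorem 1
    obtain ⟨C', hC', hsize', heval⟩ := C.exists_restrict_sup hC x
    have hsize'' : (C'.size : ℝ) ≤ (c₀ + 1) * (n : ℝ) ^ ((k : ℝ) / 4) := by
      have : (C'.size : ℝ) ≤ C.size + 1 := by exact_mod_cast hsize'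
      linarith
    have hkA : kSubsetProb n k (fun A => C'.eval (cliqueVec A) = true) =
        kSubsetProb n k (fun A => C.eval (x ⊔ cliqueVec A) = true) :=
      kSubsetProb_congr fun A => by rw [heval]
    have hf : (univ.filter fun y => C'.eval y = true) =
        univ.filter fun y => C.eval (x ⊔ y) = true :=
      filter_congr fun y _ => by rw [heval]
    have key := thm1_finite hk hδ0 hδ1 hη hn C' hC' hsize'' (hacc.trans_eq hkA.symm)
    rw [hf] at key
    have h1 := kSubsetProb_le_one n k (fun A => C.eval (x ⊔ cliqueVec A) = true)
    linarith
  · rw [not_le] at hacc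
    linarith

/-- **Theorem 1 relative to a random background, averaged** (corollary of Theorem 1 via
`thm1_relative`; the dense-dose endpoint `σ = 2(1+δ)/(k-1)` of the relative sparse-dose
statement of route PneNP/OneSlice, crux `SingleThreshold`): for `k ≥ 5`, `0 < δ ≤ k⁻³`, `η > 0`,
`0 ≤ q ≤ 1`, `n` with `LargeN k δ (c₀ + 1) η n` and a circuit `C` over `{∧₂, ∨₂, 0, 1}` with
`size C + 1 ≤ (c₀ + 1) n^{k/4}`,
`E_{x ∼ G(n,q)}[Pr_A[C(x ∪ K_A) = 1]] - E_{x ∼ G(n,q)} E_{y ∼ G(n,p⁻)}[[C(x ∪ y) = 1]]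
  ≤ η + exp(-n^{c'})`,
both expectations written as finite sums against the weights `gnpWeight`. Proof: multiply
`thm1_relative` by `gnpWeight n q x ≥ 0`, sum over `x`, and use `Σ_x gnpWeight n q x = 1`.
[cite: Rossman2010, Thm 1 (p. 4)] -/
theorem rsd_at_admissible_dose {n k : ℕ} (hk : 5 ≤ k) {δ : ℝ} (hδ0 : 0 < δ)
    (hδ1 : δ ≤ 1 / (k : ℝ) ^ 3) {c₀ η q : ℝ} (hη : 0 < η) (hq0 : 0 ≤ q) (hq1 : q ≤ 1)
    (hn : LargeN k δ (c₀ + 1) η n)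
    (C : Circuit ((⊤ : SimpleGraph (Fin n)).edgeSet)) (hC : C.IsOver monotoneBasis01)
    (hsize : (C.size : ℝ) + 1 ≤ (c₀ + 1) * (n : ℝ) ^ ((k : ℝ) / 4)) :
    (∑ x : (⊤ : SimpleGraph (Fin n)).edgeSet → Bool, gnpWeight n q x *
          kSubsetProb n k (fun A => C.eval (x ⊔ cliqueVec A) = true)) -
      (∑ x : (⊤ : SimpleGraph (Fin n)).edgeSet → Bool,
        ∑ y : (⊤ : SimpleGraph (Fin n)).edgeSet → Bool,
          gnpWeight n q x * gnpWeight n (pMinus k δ n) y *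
            (if C.eval (x ⊔ y) = true then (1 : ℝ) else 0)) ≤
      η + Real.exp (-((n : ℝ) ^ cPrime k δ)) := by
  set E := η + Real.exp (-((n : ℝ) ^ cPrime k δ)) with hE
  -- the inner sum is `w_q(x) · Pr[C(x ∨ G⁻) = 1]`
  have hinner : ∀ x : (⊤ : SimpleGraph (Fin n)).edgeSet → Bool,
      ∑ y : (⊤ : SimpleGraph (Fin n)).edgeSet → Bool,
          gnpWeight n q x * gnpWeight n (pMinus k δ n) y *
            (if C.eval (x ⊔ y) = true then (1 : ℝ) else 0) =
        gnpWeight n q x *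
          gnpProb n (pMinus k δ n) (univ.filter fun y => C.eval (x ⊔ y) = true) := by
    intro x
    rw [gnpProb_filter, mul_sum]
    refine sum_congr rfl fun y _ => ?_
    split_ifs <;> ring
  -- pointwise: `thm1_relative` times the weight of `x`
  have hpt : ∀ x : (⊤ : SimpleGraph (Fin n)).edgeSet → Bool,
      gnpWeight n q x * kSubsetProb n k (fun A => C.eval (x ⊔ cliqueVec A) = true) -
        gnpWeight n q x *
          gnpProb n (pMinus k δ n) (univ.filter fun y => C.eval (x ⊔ y) = true) ≤
        gnpWeight n q x * E := by
    intro x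
    have h := thm1_relative hk hδ0 hδ1 hη hn C hC hsize x
    rw [← mul_sub]
    exact mul_le_mul_of_nonneg_left (by linarith) (gnpWeight_nonneg hq0 hq1 x)
  -- total mass one
  have hmass : ∑ x : (⊤ : SimpleGraph (Fin n)).edgeSet → Bool, gnpWeight n q x = 1 := by
    have := gnpProb_univ n q
    rwa [gnpProb] at this
  calc _ = ∑ x : (⊤ : SimpleGraph (Fin n)).edgeSet → Bool,
        (gnpWeight n q x * kSubsetProb n k (fun A => C.eval (x ⊔ cliqueVec A) = true) -
          gnpWeight n q x *
            gnpProb n (pMinus k δ n) (univ.filter fun y => C.eval (x ⊔ y) = true)) := by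
        rw [sum_sub_distrib]
        exact congrArg _ (sum_congr rfl fun x _ => hinner x)
    _ ≤ ∑ x : (⊤ : SimpleGraph (Fin n)).edgeSet → Bool, gnpWeight n q x * E :=
        sum_le_sum fun x _ => hpt x
    _ = E := by rw [← sum_mul, hmass, one_mul]

end Literature.Computability.Complexity
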